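import Summits.BirchSwinnertonDyer.BirchSwinnertonDyer.Theorems.QuadraticBranchSignedControlPlusEtaNonsurjPrimeLFunctionRecordShape
import Summits.BirchSwinnertonDyer.BirchSwinnertonDyer.Theorems.QuadraticBranchSignedControlPlusEtaNonsurjCMUnitRecords01
import Summits.BirchSwinnertonDyer.BirchSwinnertonDyer.Theorems.QuadraticBranchSignedControlPlusEtaNonsurjCMUnitRecords02
import HarnessLib

/-!
# Route `QuadraticBranchSignedControl` (rung K8, cell `bsd-potss`), residual crux
# `PlusEtaMainConjectureNonsurj` (stmt-BirchSwinnertonDyer-19606): RANK-1 RECORDS A — Kobayashi's even main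
# conjecture at `η` at `(V,5)` for every good `a_5 = 0` model `V` of the `5`-twist of each of the 9 non-CM
# RANK-ONE curves `W` of the census that are congruent mod `5` to a CM UNIT row, MODULO the Hatley–Lei
# transfer (print), the Kraus–Oesterlé-certified congruence, the PARI shape `(L_5⁺(V,η,X)) = (X)` and named
# facts (seat `bsd-potss-k8eta-c2` g4; file 4A, records of `…PrimeLFunctionRecordShape.lean`)

Rows in this file (W ≅₅ W′, N_W < 5·10⁵, p = 5, Im ρ̄_{V,5} = C_ns⁺(5)): `26100h1` ≅₅ `900b1`, `104400dc1` ≅₅ `3600bb1`, `243900o1` ≅₅ `900b1`, `243900p1` ≅₅ `900b1`, `313200el1` ≅₅ `10800cj1`.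

THE ROWS. Crux 19606 = Kobayashi's (C1⁺_η) on the good supersingular `a_p = 0` twists `V` (`p ≥ 5`) whose
`p`-adic tower is NOT onto. Below `5·10⁵` its rank-`1` rows are 274 CM + 16 non-CM pairs (seat g3's census
HOME/k8eta-c2/g3/eta_lambdamu_merged.tsv, sha16 9e690fce77a084e4); 9 of the 16 non-CM rows are congruent
mod `5` to the `5`-twist of a CM curve `W′` of analytic rank `0` with `#Ш(W′)_an = 1` (seat g3, Kraus–Oesterlé
Prop. 4 certificates on ALL primes `ℓ ≤ μ(lcm(N_V,N_V′))/6`, kit j270714, HOME/k8eta-c2/g3/ko92_cert_r1_j270714.tsv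
sha16 4afd44cfe3644d3a), and ALL 9 have plus-`η` analytic Iwasawa invariants `(λ,μ) = (1,0)` (PARI 2.17
`ellpadiclambdamu(V,5,1,2)` first component, kit j269184/j269393/j269813). For such a row seat g4's
PRIME-`L`-FUNCTION road (`EtaPrimeRoad`, p508939/p509721: `(L_η) = (X)` prime, `X ∣ Char` from `r_an(W) = 1`,
`μ = 0` transferred from the anchor by Hatley–Lei Thm. 4.6, Thm. 4.1η rational clause + Gauss) gives (C1⁺_η)(V,5).
Each record `etaMC_r1_<W>_<W′>_5`:
* IN THE KERNEL (`decide` on Cremona's coefficients): `Δ(W) ≠ 0`; for the anchor `W′`: `Δ ≠ 0`, global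
  minimality (x11b's Kraus criterion — REUSED from seat g2's `EtaCMUnitRecords`), CM (`j ∈` the thirteen CM
  values, tree theorem `hasCM_iff_j_mem_holds`), `5 ∤ #Ш(W′)_an`;
* NAMED PUBLISHED INPUTS (hypothesis position): Kobayashi Thm. 2.2η (`h22`), Thm. 4.1η rational clause (`h41`),
  modularity (`hmod`), GZK (`hGZK`), Burungale–Flach bsd.S28 (`hS28`);
* DISPLAYED: the Hatley–Lei transfer at `η` (`hHL`, print: AIF 69 (2019) Thm. 4.6 — typing requested, bsd-littype);
  Cremona `allbsd`: `r_an(W) = 1` (`hr`), `r_an(W′) = 0` (`hr'`), `#Ш(W′)_an = 1` (`hs'`); per pair `(V′,V)`: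
  `V′[5] ≅ V[5]` (`ModPCongruent V′ V 5`, certified) and `(L_5⁺(V,η,X)) = (X)` (PARI `(λ,μ) = (1,0)` with
  `L(W,1) = 0`);
and concludes `QuadraticBranchPlusEtaMainConjectureAt V 5` for EVERY globally minimal `V = C • W^{(5)}` and
`V′ = C′ • W′^{(5)}` good at `5` with `a_5 = 0` (the census twists are such). HONEST LABEL: per-row
instances, CONDITIONAL on the displayed transfer / congruence / shape and the five named facts; the
class-wide crux 19606 and its stubs stay OPEN; nothing is booked; no label / mark / count moves; `BSD(W′,5)` is
bsd.S28, `BSD(W,5)` is claimed for no pair; BSD is not proved by any of this. `--supports stmt-BirchSwinnertonDyer-19606`.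

References: [HatleyLei2019] Thm. 4.6; [Kobayashi2003] Thm. 2.2 (p. 5), §4 + Thm. 4.1 (p. 8); [KrausOesterle1992]
Prop. 4; [BurungaleFlach2024] Thm. 1.1 + Cor. 2; [Cremona1997] Table 1; [SilvermanAEC2009] App. C §11.
-/

set_option autoImplicit false
set_option linter.dupNamespace false

noncomputable section

open scoped Classical

open CongruenceSubgroup Field Function NumberField IsDedekindDomain WeierstrassCurve
open Literature.NumberTheory.EllipticCurves
open Literature.NumberTheory.EllipticCurves.ModularForms
open Literature.NumberTheory.EllipticCurves.Rank1Residual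
open Literature.NumberTheory.EllipticCurves.Rank1Residual.Typed
open Literature.NumberTheory.EllipticCurves.Rank1Residual.X11RankOneCertificates
open Literature.NumberTheory.GaloisRepresentations
open Literature.NumberTheory.GaloisCohomology
open Literature.NumberTheory.EllipticCurves.IwasawaAlgebra
open Literature.NumberTheory.EllipticCurves.IwasawaDual ZpExtension
open Literature.NumberTheory.EllipticCurves.GreenbergVatsal2000
open Summit.BirchSwinnertonDyer.Rank1Residual.X11b.Levels
open Summit.BirchSwinnertonDyer.Rank1Residual.X11b
open Summit.BirchSwinnertonDyer.Rank1Residual.Additive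
open Summit.BirchSwinnertonDyer.Rank1Residual.Additive.SignedTwist
open scoped ContRepresentation
open Summit.BirchSwinnertonDyer.Rank1Residual.AdditivePotMult
open Summit.BirchSwinnertonDyer.Rank1Residual.O6 (ModPCongruent)

namespace Summit.BirchSwinnertonDyer.BirchSwinnertonDyer.Theorems

namespace EtaPrimeRoadRecords

/-- `26100h1` = `[0, 0, 0, -8625, 644625]` (non-CM, `N = 26100`): `Δ ≠ 0` (kernel). [cite: Cremona1997, Table 1 (label 26100h1)] -/
theorem isElliptic_26100h1 : (⟨0, 0, 0, -8625, 644625⟩ : WeierstrassCurve ℚ).IsElliptic :=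
  isElliptic_of_discOf_ne_zero 0 0 0 (-8625) 644625 (by decide +kernel)

set_option maxRecDepth 100000 in
/-- **(C1⁺_η) at `p = 5` for every good `a_5 = 0` model `V` of the `5`-twist of `26100h1`** (`N = 26100`, non-CM, image
`C_ns⁺(5)`; Cremona: `r_an = 1`, `Tam = 60`, `#tors = 1`, `#Ш_an = 1.00`; PARI plus-`η` `(λ,μ) = (1,0)`), GRANTED a
good `a_5 = 0` model `V′` of the `5`-twist of the CM ANCHOR `900b1` = `[0, 0, 0, 0, 125]` (`N = 900`; Cremona: `r_an = 0`, `#Ш_an = 1`,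
`Tam = 4`; UNIT row) with `V′[5] ≅ V[5]` (displayed; Kraus–Oesterlé certificate: all primes `ℓ ≤ 360`, 69 tested,
0 failures, kit j270714), the Hatley–Lei transfer `hHL` (displayed) and the shape `(L_5⁺(V,η,X)) = (X)` (displayed). Kernel:
`Δ(W) ≠ 0`; anchor `Δ ≠ 0` / minimality (REUSED `EtaCMUnitRecords`) / CM / `5 ∤ 1`. Named facts `h22`/`h41`/`hmod`/`hGZK`/`hS28`.
Per-row instance of `EtaPrimeRoad.etaMC_r1_of_cmUnitAnchor_of_ainvs`; CONDITIONAL; nothing booked.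
[cite: HatleyLei2019, Thm. 4.6] [cite: Kobayashi2003, §4 (p. 8)] [cite: KrausOesterle1992, Prop. 4] [cite: Cremona1997, Table 1 (labels 26100h1, 900b1)] -/
theorem etaMC_r1_26100h1_900b1_5
    (h22 : Kobayashi2003.thm22_etaSignedSelmerDual_finite_torsion)
    (h41 : Kobayashi2003.thm41_plusEtaCharIdeal_dvd)
    (hmod : hasEntireLFunction_rat) (hGZK : rank_eq_analyticRank_of_analyticRank_le_one)
    (hS28 : bsdTriple_of_hasCM_of_L_one_ne_zero) [Fact (5 : ℕ).Prime]
    (hHL : ∀ (V' : WeierstrassCurve ℚ) [V'.IsElliptic] [V'.IsGloballyMinimal]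
        (V : WeierstrassCurve ℚ) [V.IsElliptic] [V.IsGloballyMinimal],
        5 ≤ 5 → V'.HasGoodReductionAtPrime 5 → V'.frobeniusTrace 5 = 0 →
        V.HasGoodReductionAtPrime 5 → V.frobeniusTrace 5 = 0 → ModPCongruent V' V 5 →
      (∀ (K₀ : Type) [Field K₀] [NumberField K₀] [IsCyclotomicExtension {5} ℚ K₀]
          [(galRange (K := ℚ) K₀).Normal] (ηq : absoluteGaloisGroup ℚ →* ℤˣ),
          (∀ σ ∈ galRange (K := ℚ) K₀, ηq σ = 1) → ηq ≠ 1 →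
        ∀ (κ : ZpExtension ℚ 5) (γ : absoluteGaloisGroup ℚ),
          κ.IsCyclotomic → κ.IsTopGenerator γ → γ ∈ galRange (K := ℚ) K₀ →
        ∀ (D : EtaSignedSelmerDualData V' κ K₀ ℚ_[5] ηq γ 1) (g : IwasawaAlgebra 5),
          D.charIdeal = Ideal.span {g} → HasUnitContent g) →
      (∀ (K₀ : Type) [Field K₀] [NumberField K₀] [IsCyclotomicExtension {5} ℚ K₀]
          [(galRange (K := ℚ) K₀).Normal] (ηq : absoluteGaloisGroup ℚ →* ℤˣ),
          (∀ σ ∈ galRange (K := ℚ) K₀, ηq σ = 1) → ηq ≠ 1 →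
        ∀ (κ : ZpExtension ℚ 5) (γ : absoluteGaloisGroup ℚ),
          κ.IsCyclotomic → κ.IsTopGenerator γ → γ ∈ galRange (K := ℚ) K₀ →
        ∀ (D : EtaSignedSelmerDualData V κ K₀ ℚ_[5] ηq γ 1) (g : IwasawaAlgebra 5),
          D.charIdeal = Ideal.span {g} → HasUnitContent g))
    (W' : WeierstrassCurve ℚ) (hW' : W' = ⟨0, 0, 0, 0, 125⟩) (hr' : W'.analyticRank = 0)
    (hs' : shaAn W' = ((1 : ℕ) : ℂ))
    (W : WeierstrassCurve ℚ) (hW : W = ⟨0, 0, 0, -8625, 644625⟩) (hr : W.analyticRank = 1) :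
    ∀ (V' : WeierstrassCurve ℚ) [V'.IsElliptic] [V'.IsGloballyMinimal]
      (V : WeierstrassCurve ℚ) [V.IsElliptic] [V.IsGloballyMinimal],
      (∃ C' : VariableChange ℚ, C' • W'.quadraticTwist (5) = V') →
      V'.HasGoodReductionAtPrime 5 → V'.frobeniusTrace 5 = 0 →
      (∃ C : VariableChange ℚ, C • W.quadraticTwist (5) = V) →
      V.HasGoodReductionAtPrime 5 → V.frobeniusTrace 5 = 0 → ModPCongruent V' V 5 →
      (∀ {N : ℕ} [NeZero N] {f : CuspForm (Gamma0 N) 2}, IsNewformOf V f →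
        ∀ (ϖ : ℚ), (if Even (5 / 2) then (ϖ : ℝ) * V.realPeriodRat = plusPeriod f
            else (ϖ : ℝ) * V.imaginaryPeriodRat = minusPeriod f) →
        ∀ (Lη : IwasawaAlgebra 5), IsQuadraticBranchPlusLFunction f 5 ϖ Lη →
          Ideal.span {Lη} = Ideal.span {(PowerSeries.X : IwasawaAlgebra 5)}) →
        QuadraticBranchPlusEtaMainConjectureAt V 5 := by
  subst hW' hW
  intro V' _ _ V _ _ hC' hgood' hap' hC hgood hap hcong hX
  obtain ⟨C', hCV'⟩ := hC'
  obtain ⟨C, hCV⟩ := hC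
  have hD : ((-1 : ℚ) ^ ((5 : ℕ) / 2) * ((5 : ℕ) : ℚ)) = 5 := by norm_num
  exact @EtaPrimeRoad.etaMC_r1_of_cmUnitAnchor_of_ainvs 5 _ h22 h41 hmod hGZK hS28 (by norm_num) hHL
    0 0 0 0 125 EtaCMUnitRecords.isElliptic_900b1 EtaCMUnitRecords.isGloballyMinimal_900b1 (by decide +kernel)
    hr' _ hs' (by decide) _ isElliptic_26100h1 hr V' _ _ C' (by rw [hD]; exact hCV') hgood' hap' V _ _ C
    (by rw [hD]; exact hCV) hgood hap hcong hX

/-- `104400dc1` = `[0, 0, 0, -8625, -644625]` (non-CM, `N = 104400`): `Δ ≠ 0` (kernel). [cite: Cremona1997, Table 1 (label 104400dc1)] -/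
theorem isElliptic_104400dc1 : (⟨0, 0, 0, -8625, -644625⟩ : WeierstrassCurve ℚ).IsElliptic :=
  isElliptic_of_discOf_ne_zero 0 0 0 (-8625) (-644625) (by decide +kernel)

set_option maxRecDepth 100000 in
/-- **(C1⁺_η) at `p = 5` for every good `a_5 = 0` model `V` of the `5`-twist of `104400dc1`** (`N = 104400`, non-CM, image
`C_ns⁺(5)`; Cremona: `r_an = 1`, `Tam = 20`, `#tors = 1`, `#Ш_an = 1.00`; PARI plus-`η` `(λ,μ) = (1,0)`), GRANTED a
good `a_5 = 0` model `V′` of the `5`-twist of the CM ANCHOR `3600bb1` = `[0, 0, 0, 0, -125]` (`N = 3600`; Cremona: `r_an = 0`, `#Ш_an = 1`,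
`Tam = 4`; UNIT row) with `V′[5] ≅ V[5]` (displayed; Kraus–Oesterlé certificate: all primes `ℓ ≤ 1440`, 225 tested,
0 failures, kit j270714), the Hatley–Lei transfer `hHL` (displayed) and the shape `(L_5⁺(V,η,X)) = (X)` (displayed). Kernel:
`Δ(W) ≠ 0`; anchor `Δ ≠ 0` / minimality (REUSED `EtaCMUnitRecords`) / CM / `5 ∤ 1`. Named facts `h22`/`h41`/`hmod`/`hGZK`/`hS28`.
Per-row instance of `EtaPrimeRoad.etaMC_r1_of_cmUnitAnchor_of_ainvs`; CONDITIONAL; nothing booked.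
[cite: HatleyLei2019, Thm. 4.6] [cite: Kobayashi2003, §4 (p. 8)] [cite: KrausOesterle1992, Prop. 4] [cite: Cremona1997, Table 1 (labels 104400dc1, 3600bb1)] -/
theorem etaMC_r1_104400dc1_3600bb1_5
    (h22 : Kobayashi2003.thm22_etaSignedSelmerDual_finite_torsion)
    (h41 : Kobayashi2003.thm41_plusEtaCharIdeal_dvd)
    (hmod : hasEntireLFunction_rat) (hGZK : rank_eq_analyticRank_of_analyticRank_le_one)
    (hS28 : bsdTriple_of_hasCM_of_L_one_ne_zero) [Fact (5 : ℕ).Prime]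
    (hHL : ∀ (V' : WeierstrassCurve ℚ) [V'.IsElliptic] [V'.IsGloballyMinimal]
        (V : WeierstrassCurve ℚ) [V.IsElliptic] [V.IsGloballyMinimal],
        5 ≤ 5 → V'.HasGoodReductionAtPrime 5 → V'.frobeniusTrace 5 = 0 →
        V.HasGoodReductionAtPrime 5 → V.frobeniusTrace 5 = 0 → ModPCongruent V' V 5 →
      (∀ (K₀ : Type) [Field K₀] [NumberField K₀] [IsCyclotomicExtension {5} ℚ K₀]
          [(galRange (K := ℚ) K₀).Normal] (ηq : absoluteGaloisGroup ℚ →* ℤˣ),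
          (∀ σ ∈ galRange (K := ℚ) K₀, ηq σ = 1) → ηq ≠ 1 →
        ∀ (κ : ZpExtension ℚ 5) (γ : absoluteGaloisGroup ℚ),
          κ.IsCyclotomic → κ.IsTopGenerator γ → γ ∈ galRange (K := ℚ) K₀ →
        ∀ (D : EtaSignedSelmerDualData V' κ K₀ ℚ_[5] ηq γ 1) (g : IwasawaAlgebra 5),
          D.charIdeal = Ideal.span {g} → HasUnitContent g) →
      (∀ (K₀ : Type) [Field K₀] [NumberField K₀] [IsCyclotomicExtension {5} ℚ K₀]
          [(galRange (K := ℚ) K₀).Normal] (ηq : absoluteGaloisGroup ℚ →* ℤˣ),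
          (∀ σ ∈ galRange (K := ℚ) K₀, ηq σ = 1) → ηq ≠ 1 →
        ∀ (κ : ZpExtension ℚ 5) (γ : absoluteGaloisGroup ℚ),
          κ.IsCyclotomic → κ.IsTopGenerator γ → γ ∈ galRange (K := ℚ) K₀ →
        ∀ (D : EtaSignedSelmerDualData V κ K₀ ℚ_[5] ηq γ 1) (g : IwasawaAlgebra 5),
          D.charIdeal = Ideal.span {g} → HasUnitContent g))
    (W' : WeierstrassCurve ℚ) (hW' : W' = ⟨0, 0, 0, 0, -125⟩) (hr' : W'.analyticRank = 0)
    (hs' : shaAn W' = ((1 : ℕ) : ℂ))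
    (W : WeierstrassCurve ℚ) (hW : W = ⟨0, 0, 0, -8625, -644625⟩) (hr : W.analyticRank = 1) :
    ∀ (V' : WeierstrassCurve ℚ) [V'.IsElliptic] [V'.IsGloballyMinimal]
      (V : WeierstrassCurve ℚ) [V.IsElliptic] [V.IsGloballyMinimal],
      (∃ C' : VariableChange ℚ, C' • W'.quadraticTwist (5) = V') →
      V'.HasGoodReductionAtPrime 5 → V'.frobeniusTrace 5 = 0 →
      (∃ C : VariableChange ℚ, C • W.quadraticTwist (5) = V) →
      V.HasGoodReductionAtPrime 5 → V.frobeniusTrace 5 = 0 → ModPCongruent V' V 5 →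
      (∀ {N : ℕ} [NeZero N] {f : CuspForm (Gamma0 N) 2}, IsNewformOf V f →
        ∀ (ϖ : ℚ), (if Even (5 / 2) then (ϖ : ℝ) * V.realPeriodRat = plusPeriod f
            else (ϖ : ℝ) * V.imaginaryPeriodRat = minusPeriod f) →
        ∀ (Lη : IwasawaAlgebra 5), IsQuadraticBranchPlusLFunction f 5 ϖ Lη →
          Ideal.span {Lη} = Ideal.span {(PowerSeries.X : IwasawaAlgebra 5)}) →
        QuadraticBranchPlusEtaMainConjectureAt V 5 := by
  subst hW' hW
  intro V' _ _ V _ _ hC' hgood' hap' hC hgood hap hcong hX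
  obtain ⟨C', hCV'⟩ := hC'
  obtain ⟨C, hCV⟩ := hC
  have hD : ((-1 : ℚ) ^ ((5 : ℕ) / 2) * ((5 : ℕ) : ℚ)) = 5 := by norm_num
  exact @EtaPrimeRoad.etaMC_r1_of_cmUnitAnchor_of_ainvs 5 _ h22 h41 hmod hGZK hS28 (by norm_num) hHL
    0 0 0 0 (-125) EtaCMUnitRecords.isElliptic_3600bb1 EtaCMUnitRecords.isGloballyMinimal_3600bb1 (by decide +kernel)
    hr' _ hs' (by decide) _ isElliptic_104400dc1 hr V' _ _ C' (by rw [hD]; exact hCV') hgood' hap' V _ _ C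
    (by rw [hD]; exact hCV) hgood hap hcong hX

/-- `243900o1` = `[0, 0, 0, -2607000, -1503171500]` (non-CM, `N = 243900`): `Δ ≠ 0` (kernel). [cite: Cremona1997, Table 1 (label 243900o1)] -/
theorem isElliptic_243900o1 : (⟨0, 0, 0, -2607000, -1503171500⟩ : WeierstrassCurve ℚ).IsElliptic :=
  isElliptic_of_discOf_ne_zero 0 0 0 (-2607000) (-1503171500) (by decide +kernel)

set_option maxRecDepth 100000 in
/-- **(C1⁺_η) at `p = 5` for every good `a_5 = 0` model `V` of the `5`-twist of `243900o1`** (`N = 243900`, non-CM, image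
`C_ns⁺(5)`; Cremona: `r_an = 1`, `Tam = 20`, `#tors = 1`, `#Ш_an = 1.00`; PARI plus-`η` `(λ,μ) = (1,0)`), GRANTED a
good `a_5 = 0` model `V′` of the `5`-twist of the CM ANCHOR `900b1` = `[0, 0, 0, 0, 125]` (`N = 900`; Cremona: `r_an = 0`, `#Ш_an = 1`,
`Tam = 4`; UNIT row) with `V′[5] ≅ V[5]` (displayed; Kraus–Oesterlé certificate: all primes `ℓ ≤ 3264`, 458 tested,
0 failures, kit j270714), the Hatley–Lei transfer `hHL` (displayed) and the shape `(L_5⁺(V,η,X)) = (X)` (displayed). Kernel: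
`Δ(W) ≠ 0`; anchor `Δ ≠ 0` / minimality (REUSED `EtaCMUnitRecords`) / CM / `5 ∤ 1`. Named facts `h22`/`h41`/`hmod`/`hGZK`/`hS28`.
Per-row instance of `EtaPrimeRoad.etaMC_r1_of_cmUnitAnchor_of_ainvs`; CONDITIONAL; nothing booked.
[cite: HatleyLei2019, Thm. 4.6] [cite: Kobayashi2003, §4 (p. 8)] [cite: KrausOesterle1992, Prop. 4] [cite: Cremona1997, Table 1 (labels 243900o1, 900b1)] -/
theorem etaMC_r1_243900o1_900b1_5
    (h22 : Kobayashi2003.thm22_etaSignedSelmerDual_finite_torsion)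
    (h41 : Kobayashi2003.thm41_plusEtaCharIdeal_dvd)
    (hmod : hasEntireLFunction_rat) (hGZK : rank_eq_analyticRank_of_analyticRank_le_one)
    (hS28 : bsdTriple_of_hasCM_of_L_one_ne_zero) [Fact (5 : ℕ).Prime]
    (hHL : ∀ (V' : WeierstrassCurve ℚ) [V'.IsElliptic] [V'.IsGloballyMinimal]
        (V : WeierstrassCurve ℚ) [V.IsElliptic] [V.IsGloballyMinimal],
        5 ≤ 5 → V'.HasGoodReductionAtPrime 5 → V'.frobeniusTrace 5 = 0 →
        V.HasGoodReductionAtPrime 5 → V.frobeniusTrace 5 = 0 → ModPCongruent V' V 5 →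
      (∀ (K₀ : Type) [Field K₀] [NumberField K₀] [IsCyclotomicExtension {5} ℚ K₀]
          [(galRange (K := ℚ) K₀).Normal] (ηq : absoluteGaloisGroup ℚ →* ℤˣ),
          (∀ σ ∈ galRange (K := ℚ) K₀, ηq σ = 1) → ηq ≠ 1 →
        ∀ (κ : ZpExtension ℚ 5) (γ : absoluteGaloisGroup ℚ),
          κ.IsCyclotomic → κ.IsTopGenerator γ → γ ∈ galRange (K := ℚ) K₀ →
        ∀ (D : EtaSignedSelmerDualData V' κ K₀ ℚ_[5] ηq γ 1) (g : IwasawaAlgebra 5),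
          D.charIdeal = Ideal.span {g} → HasUnitContent g) →
      (∀ (K₀ : Type) [Field K₀] [NumberField K₀] [IsCyclotomicExtension {5} ℚ K₀]
          [(galRange (K := ℚ) K₀).Normal] (ηq : absoluteGaloisGroup ℚ →* ℤˣ),
          (∀ σ ∈ galRange (K := ℚ) K₀, ηq σ = 1) → ηq ≠ 1 →
        ∀ (κ : ZpExtension ℚ 5) (γ : absoluteGaloisGroup ℚ),
          κ.IsCyclotomic → κ.IsTopGenerator γ → γ ∈ galRange (K := ℚ) K₀ →
        ∀ (D : EtaSignedSelmerDualData V κ K₀ ℚ_[5] ηq γ 1) (g : IwasawaAlgebra 5),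
          D.charIdeal = Ideal.span {g} → HasUnitContent g))
    (W' : WeierstrassCurve ℚ) (hW' : W' = ⟨0, 0, 0, 0, 125⟩) (hr' : W'.analyticRank = 0)
    (hs' : shaAn W' = ((1 : ℕ) : ℂ))
    (W : WeierstrassCurve ℚ) (hW : W = ⟨0, 0, 0, -2607000, -1503171500⟩) (hr : W.analyticRank = 1) :
    ∀ (V' : WeierstrassCurve ℚ) [V'.IsElliptic] [V'.IsGloballyMinimal]
      (V : WeierstrassCurve ℚ) [V.IsElliptic] [V.IsGloballyMinimal],
      (∃ C' : VariableChange ℚ, C' • W'.quadraticTwist (5) = V') →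
      V'.HasGoodReductionAtPrime 5 → V'.frobeniusTrace 5 = 0 →
      (∃ C : VariableChange ℚ, C • W.quadraticTwist (5) = V) →
      V.HasGoodReductionAtPrime 5 → V.frobeniusTrace 5 = 0 → ModPCongruent V' V 5 →
      (∀ {N : ℕ} [NeZero N] {f : CuspForm (Gamma0 N) 2}, IsNewformOf V f →
        ∀ (ϖ : ℚ), (if Even (5 / 2) then (ϖ : ℝ) * V.realPeriodRat = plusPeriod f
            else (ϖ : ℝ) * V.imaginaryPeriodRat = minusPeriod f) →
        ∀ (Lη : IwasawaAlgebra 5), IsQuadraticBranchPlusLFunction f 5 ϖ Lη →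
          Ideal.span {Lη} = Ideal.span {(PowerSeries.X : IwasawaAlgebra 5)}) →
        QuadraticBranchPlusEtaMainConjectureAt V 5 := by
  subst hW' hW
  intro V' _ _ V _ _ hC' hgood' hap' hC hgood hap hcong hX
  obtain ⟨C', hCV'⟩ := hC'
  obtain ⟨C, hCV⟩ := hC
  have hD : ((-1 : ℚ) ^ ((5 : ℕ) / 2) * ((5 : ℕ) : ℚ)) = 5 := by norm_num
  exact @EtaPrimeRoad.etaMC_r1_of_cmUnitAnchor_of_ainvs 5 _ h22 h41 hmod hGZK hS28 (by norm_num) hHL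
    0 0 0 0 125 EtaCMUnitRecords.isElliptic_900b1 EtaCMUnitRecords.isGloballyMinimal_900b1 (by decide +kernel)
    hr' _ hs' (by decide) _ isElliptic_243900o1 hr V' _ _ C' (by rw [hD]; exact hCV') hgood' hap' V _ _ C
    (by rw [hD]; exact hCV) hgood hap hcong hX

/-- `243900p1` = `[0, 0, 0, -23463000, 40585630500]` (non-CM, `N = 243900`): `Δ ≠ 0` (kernel). [cite: Cremona1997, Table 1 (label 243900p1)] -/
theorem isElliptic_243900p1 : (⟨0, 0, 0, -23463000, 40585630500⟩ : WeierstrassCurve ℚ).IsElliptic :=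
  isElliptic_of_discOf_ne_zero 0 0 0 (-23463000) 40585630500 (by decide +kernel)

set_option maxRecDepth 100000 in
/-- **(C1⁺_η) at `p = 5` for every good `a_5 = 0` model `V` of the `5`-twist of `243900p1`** (`N = 243900`, non-CM, image
`C_ns⁺(5)`; Cremona: `r_an = 1`, `Tam = 60`, `#tors = 1`, `#Ш_an = 1.00`; PARI plus-`η` `(λ,μ) = (1,0)`), GRANTED a
good `a_5 = 0` model `V′` of the `5`-twist of the CM ANCHOR `900b1` = `[0, 0, 0, 0, 125]` (`N = 900`; Cremona: `r_an = 0`, `#Ш_an = 1`,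
`Tam = 4`; UNIT row) with `V′[5] ≅ V[5]` (displayed; Kraus–Oesterlé certificate: all primes `ℓ ≤ 3264`, 458 tested,
0 failures, kit j270714), the Hatley–Lei transfer `hHL` (displayed) and the shape `(L_5⁺(V,η,X)) = (X)` (displayed). Kernel:
`Δ(W) ≠ 0`; anchor `Δ ≠ 0` / minimality (REUSED `EtaCMUnitRecords`) / CM / `5 ∤ 1`. Named facts `h22`/`h41`/`hmod`/`hGZK`/`hS28`.
Per-row instance of `EtaPrimeRoad.etaMC_r1_of_cmUnitAnchor_of_ainvs`; CONDITIONAL; nothing booked.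
[cite: HatleyLei2019, Thm. 4.6] [cite: Kobayashi2003, §4 (p. 8)] [cite: KrausOesterle1992, Prop. 4] [cite: Cremona1997, Table 1 (labels 243900p1, 900b1)] -/
theorem etaMC_r1_243900p1_900b1_5
    (h22 : Kobayashi2003.thm22_etaSignedSelmerDual_finite_torsion)
    (h41 : Kobayashi2003.thm41_plusEtaCharIdeal_dvd)
    (hmod : hasEntireLFunction_rat) (hGZK : rank_eq_analyticRank_of_analyticRank_le_one)
    (hS28 : bsdTriple_of_hasCM_of_L_one_ne_zero) [Fact (5 : ℕ).Prime]
    (hHL : ∀ (V' : WeierstrassCurve ℚ) [V'.IsElliptic] [V'.IsGloballyMinimal]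
        (V : WeierstrassCurve ℚ) [V.IsElliptic] [V.IsGloballyMinimal],
        5 ≤ 5 → V'.HasGoodReductionAtPrime 5 → V'.frobeniusTrace 5 = 0 →
        V.HasGoodReductionAtPrime 5 → V.frobeniusTrace 5 = 0 → ModPCongruent V' V 5 →
      (∀ (K₀ : Type) [Field K₀] [NumberField K₀] [IsCyclotomicExtension {5} ℚ K₀]
          [(galRange (K := ℚ) K₀).Normal] (ηq : absoluteGaloisGroup ℚ →* ℤˣ),
          (∀ σ ∈ galRange (K := ℚ) K₀, ηq σ = 1) → ηq ≠ 1 →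
        ∀ (κ : ZpExtension ℚ 5) (γ : absoluteGaloisGroup ℚ),
          κ.IsCyclotomic → κ.IsTopGenerator γ → γ ∈ galRange (K := ℚ) K₀ →
        ∀ (D : EtaSignedSelmerDualData V' κ K₀ ℚ_[5] ηq γ 1) (g : IwasawaAlgebra 5),
          D.charIdeal = Ideal.span {g} → HasUnitContent g) →
      (∀ (K₀ : Type) [Field K₀] [NumberField K₀] [IsCyclotomicExtension {5} ℚ K₀]
          [(galRange (K := ℚ) K₀).Normal] (ηq : absoluteGaloisGroup ℚ →* ℤˣ),
          (∀ σ ∈ galRange (K := ℚ) K₀, ηq σ = 1) → ηq ≠ 1 →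
        ∀ (κ : ZpExtension ℚ 5) (γ : absoluteGaloisGroup ℚ),
          κ.IsCyclotomic → κ.IsTopGenerator γ → γ ∈ galRange (K := ℚ) K₀ →
        ∀ (D : EtaSignedSelmerDualData V κ K₀ ℚ_[5] ηq γ 1) (g : IwasawaAlgebra 5),
          D.charIdeal = Ideal.span {g} → HasUnitContent g))
    (W' : WeierstrassCurve ℚ) (hW' : W' = ⟨0, 0, 0, 0, 125⟩) (hr' : W'.analyticRank = 0)
    (hs' : shaAn W' = ((1 : ℕ) : ℂ))
    (W : WeierstrassCurve ℚ) (hW : W = ⟨0, 0, 0, -23463000, 40585630500⟩) (hr : W.analyticRank = 1) :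
    ∀ (V' : WeierstrassCurve ℚ) [V'.IsElliptic] [V'.IsGloballyMinimal]
      (V : WeierstrassCurve ℚ) [V.IsElliptic] [V.IsGloballyMinimal],
      (∃ C' : VariableChange ℚ, C' • W'.quadraticTwist (5) = V') →
      V'.HasGoodReductionAtPrime 5 → V'.frobeniusTrace 5 = 0 →
      (∃ C : VariableChange ℚ, C • W.quadraticTwist (5) = V) →
      V.HasGoodReductionAtPrime 5 → V.frobeniusTrace 5 = 0 → ModPCongruent V' V 5 →
      (∀ {N : ℕ} [NeZero N] {f : CuspForm (Gamma0 N) 2}, IsNewformOf V f →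
        ∀ (ϖ : ℚ), (if Even (5 / 2) then (ϖ : ℝ) * V.realPeriodRat = plusPeriod f
            else (ϖ : ℝ) * V.imaginaryPeriodRat = minusPeriod f) →
        ∀ (Lη : IwasawaAlgebra 5), IsQuadraticBranchPlusLFunction f 5 ϖ Lη →
          Ideal.span {Lη} = Ideal.span {(PowerSeries.X : IwasawaAlgebra 5)}) →
        QuadraticBranchPlusEtaMainConjectureAt V 5 := by
  subst hW' hW
  intro V' _ _ V _ _ hC' hgood' hap' hC hgood hap hcong hX
  obtain ⟨C', hCV'⟩ := hC'
  obtain ⟨C, hCV⟩ := hC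
  have hD : ((-1 : ℚ) ^ ((5 : ℕ) / 2) * ((5 : ℕ) : ℚ)) = 5 := by norm_num
  exact @EtaPrimeRoad.etaMC_r1_of_cmUnitAnchor_of_ainvs 5 _ h22 h41 hmod hGZK hS28 (by norm_num) hHL
    0 0 0 0 125 EtaCMUnitRecords.isElliptic_900b1 EtaCMUnitRecords.isGloballyMinimal_900b1 (by decide +kernel)
    hr' _ hs' (by decide) _ isElliptic_243900p1 hr V' _ _ C' (by rw [hD]; exact hCV') hgood' hap' V _ _ C
    (by rw [hD]; exact hCV) hgood hap hcong hX

/-- `313200el1` = `[0, 0, 0, -705375, -135465750]` (non-CM, `N = 313200`): `Δ ≠ 0` (kernel). [cite: Cremona1997, Table 1 (label 313200el1)] -/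
theorem isElliptic_313200el1 : (⟨0, 0, 0, -705375, -135465750⟩ : WeierstrassCurve ℚ).IsElliptic :=
  isElliptic_of_discOf_ne_zero 0 0 0 (-705375) (-135465750) (by decide +kernel)

set_option maxRecDepth 100000 in
/-- **(C1⁺_η) at `p = 5` for every good `a_5 = 0` model `V` of the `5`-twist of `313200el1`** (`N = 313200`, non-CM, image
`C_ns⁺(5)`; Cremona: `r_an = 1`, `Tam = 10`, `#tors = 1`, `#Ш_an = 1.00`; PARI plus-`η` `(λ,μ) = (1,0)`), GRANTED a
good `a_5 = 0` model `V′` of the `5`-twist of the CM ANCHOR `10800cj1` = `[0, 0, 0, 0, -500]` (`N = 10800`; Cremona: `r_an = 0`, `#Ш_an = 1`,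
`Tam = 4`; UNIT row) with `V′[5] ≅ V[5]` (displayed; Kraus–Oesterlé certificate: all primes `ℓ ≤ 4320`, 587 tested,
0 failures, kit j270714), the Hatley–Lei transfer `hHL` (displayed) and the shape `(L_5⁺(V,η,X)) = (X)` (displayed). Kernel:
`Δ(W) ≠ 0`; anchor `Δ ≠ 0` / minimality (REUSED `EtaCMUnitRecords`) / CM / `5 ∤ 1`. Named facts `h22`/`h41`/`hmod`/`hGZK`/`hS28`.
Per-row instance of `EtaPrimeRoad.etaMC_r1_of_cmUnitAnchor_of_ainvs`; CONDITIONAL; nothing booked.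
[cite: HatleyLei2019, Thm. 4.6] [cite: Kobayashi2003, §4 (p. 8)] [cite: KrausOesterle1992, Prop. 4] [cite: Cremona1997, Table 1 (labels 313200el1, 10800cj1)] -/
theorem etaMC_r1_313200el1_10800cj1_5
    (h22 : Kobayashi2003.thm22_etaSignedSelmerDual_finite_torsion)
    (h41 : Kobayashi2003.thm41_plusEtaCharIdeal_dvd)
    (hmod : hasEntireLFunction_rat) (hGZK : rank_eq_analyticRank_of_analyticRank_le_one)
    (hS28 : bsdTriple_of_hasCM_of_L_one_ne_zero) [Fact (5 : ℕ).Prime]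
    (hHL : ∀ (V' : WeierstrassCurve ℚ) [V'.IsElliptic] [V'.IsGloballyMinimal]
        (V : WeierstrassCurve ℚ) [V.IsElliptic] [V.IsGloballyMinimal],
        5 ≤ 5 → V'.HasGoodReductionAtPrime 5 → V'.frobeniusTrace 5 = 0 →
        V.HasGoodReductionAtPrime 5 → V.frobeniusTrace 5 = 0 → ModPCongruent V' V 5 →
      (∀ (K₀ : Type) [Field K₀] [NumberField K₀] [IsCyclotomicExtension {5} ℚ K₀]
          [(galRange (K := ℚ) K₀).Normal] (ηq : absoluteGaloisGroup ℚ →* ℤˣ),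
          (∀ σ ∈ galRange (K := ℚ) K₀, ηq σ = 1) → ηq ≠ 1 →
        ∀ (κ : ZpExtension ℚ 5) (γ : absoluteGaloisGroup ℚ),
          κ.IsCyclotomic → κ.IsTopGenerator γ → γ ∈ galRange (K := ℚ) K₀ →
        ∀ (D : EtaSignedSelmerDualData V' κ K₀ ℚ_[5] ηq γ 1) (g : IwasawaAlgebra 5),
          D.charIdeal = Ideal.span {g} → HasUnitContent g) →
      (∀ (K₀ : Type) [Field K₀] [NumberField K₀] [IsCyclotomicExtension {5} ℚ K₀]
          [(galRange (K := ℚ) K₀).Normal] (ηq : absoluteGaloisGroup ℚ →* ℤˣ),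
          (∀ σ ∈ galRange (K := ℚ) K₀, ηq σ = 1) → ηq ≠ 1 →
        ∀ (κ : ZpExtension ℚ 5) (γ : absoluteGaloisGroup ℚ),
          κ.IsCyclotomic → κ.IsTopGenerator γ → γ ∈ galRange (K := ℚ) K₀ →
        ∀ (D : EtaSignedSelmerDualData V κ K₀ ℚ_[5] ηq γ 1) (g : IwasawaAlgebra 5),
          D.charIdeal = Ideal.span {g} → HasUnitContent g))
    (W' : WeierstrassCurve ℚ) (hW' : W' = ⟨0, 0, 0, 0, -500⟩) (hr' : W'.analyticRank = 0)
    (hs' : shaAn W' = ((1 : ℕ) : ℂ))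
    (W : WeierstrassCurve ℚ) (hW : W = ⟨0, 0, 0, -705375, -135465750⟩) (hr : W.analyticRank = 1) :
    ∀ (V' : WeierstrassCurve ℚ) [V'.IsElliptic] [V'.IsGloballyMinimal]
      (V : WeierstrassCurve ℚ) [V.IsElliptic] [V.IsGloballyMinimal],
      (∃ C' : VariableChange ℚ, C' • W'.quadraticTwist (5) = V') →
      V'.HasGoodReductionAtPrime 5 → V'.frobeniusTrace 5 = 0 →
      (∃ C : VariableChange ℚ, C • W.quadraticTwist (5) = V) →
      V.HasGoodReductionAtPrime 5 → V.frobeniusTrace 5 = 0 → ModPCongruent V' V 5 →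
      (∀ {N : ℕ} [NeZero N] {f : CuspForm (Gamma0 N) 2}, IsNewformOf V f →
        ∀ (ϖ : ℚ), (if Even (5 / 2) then (ϖ : ℝ) * V.realPeriodRat = plusPeriod f
            else (ϖ : ℝ) * V.imaginaryPeriodRat = minusPeriod f) →
        ∀ (Lη : IwasawaAlgebra 5), IsQuadraticBranchPlusLFunction f 5 ϖ Lη →
          Ideal.span {Lη} = Ideal.span {(PowerSeries.X : IwasawaAlgebra 5)}) →
        QuadraticBranchPlusEtaMainConjectureAt V 5 := by
  subst hW' hW
  intro V' _ _ V _ _ hC' hgood' hap' hC hgood hap hcong hX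
  obtain ⟨C', hCV'⟩ := hC'
  obtain ⟨C, hCV⟩ := hC
  have hD : ((-1 : ℚ) ^ ((5 : ℕ) / 2) * ((5 : ℕ) : ℚ)) = 5 := by norm_num
  exact @EtaPrimeRoad.etaMC_r1_of_cmUnitAnchor_of_ainvs 5 _ h22 h41 hmod hGZK hS28 (by norm_num) hHL
    0 0 0 0 (-500) EtaCMUnitRecords.isElliptic_10800cj1 EtaCMUnitRecords.isGloballyMinimal_10800cj1 (by decide +kernel)
    hr' _ hs' (by decide) _ isElliptic_313200el1 hr V' _ _ C' (by rw [hD]; exact hCV') hgood' hap' V _ _ C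
    (by rw [hD]; exact hCV) hgood hap hcong hX

end EtaPrimeRoadRecords

end Summit.BirchSwinnertonDyer.BirchSwinnertonDyer.Theorems

end
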